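import Summits.BirchSwinnertonDyer.BirchSwinnertonDyer.Theorems.ResidualThetaTransportAtTwoResidualSignedLambdaLowerCMAtTwoAtTwoCharacter
import Summits.BirchSwinnertonDyer.BirchSwinnertonDyer.Theorems.ResidualThetaTransportAtTwoResidualSignedLambdaLowerCMAtTwoAtTwoPlus
import Summits.BirchSwinnertonDyer.BirchSwinnertonDyer.Theorems.ResidualThetaTransportAtTwoResidualSignedLambdaLowerCMAtTwoAtTwoPerfect
import Summits.BirchSwinnertonDyer.BirchSwinnertonDyer.Theorems.ResidualThetaTransportAtTwoResidualSignedLambdaLowerCMAtTwoDlocPadicModule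
import HarnessLib

/-!
# T1 — THE ATTWO PACKAGE of the glue of line `onepair`: `∃ (ℤ₂-structure on D₂) (π₂ : AtTwoPins π), (PERF₂) ∧ ∃ E⁺, hSg ∧ hπker`

Route `ResidualThetaTransportAtTwo` (RTT), crux RSL_g `ResidualSignedLambdaLowerCMAtTwo` (stmt-BirchSwinnertonDyer-22608), line «onepair» (skeleton v3d), GLUE-SPEC-g18
§1 **T1** — the package the LEAD's assembly `onePairSupply_of_packages` (desk g18/SupplyOfPackages.lean) consumes through the binders
`[Module ℤ_[2] (Dloc … π.v)] (π₂ : AtTwoPins …) (hperf : Function.Surjective π₂.c₂) (Eplus : AddSubgroup (Dloc … π.v)) (hSg : …) (hπker : …)`.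
Seat `prover-bsd-wall-tp2-p2x-w2` g20 (`--supports`, closes nothing). THEOREMS ONLY (no definition, no named fact, no instance, no `sorry`). BSD is not proved
by any of this; RSL_g (22608) stays OPEN.

**`exists_atTwoPins_perfect`**: on the habitat of RSL_g (`GoodSS W 2`, `κ` cyclotomic, the transport family `Θ` with `hΘ`, the Selmer-type subgroup `Sg` with
its membership predicate `plusSelmerSet`) and for every pin bundle `π : OnePairPins …`, there are: the `ℤ₂`-structure `dlocModule` on `D₂ = Dloc … π.v` (LEAD,
p702669; `hD₂` by `rfl`), a pin bundle `π₂ : AtTwoPins π` whose `c₂` is THE value character of part 2 (`exists_c₂`, p704721: (VAL) = `hc₂`, (LIN) = `hc₂_smul`),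
(PERF₂) `Function.Surjective π₂.c₂` (part 4 `surjective_of_valuePin`), and the plus subgroup `E⁺` with the Selmer dictionary `hSg` and the Coleman kernel reading
`hπker` (part 3 `exists_Eplus`, p704499, fed with `π.col` / `π.hcol_ker`).

References: [Kobayashi2003] Thm. 6.2, (8.23) (p. 18); [PerrinRiou1994Invent] §3.6.1; [MilneADT2006] I §6, Thm. 4.10; [GreenbergVatsal2000] §2 Prop. 2.4.
-/

set_option autoImplicit false
-- the Theorems namespace of this sub repeats the summit name by design (D-0017 nested layout)
set_option linter.dupNamespace false

noncomputable section

open scoped Classical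

namespace Summit.BirchSwinnertonDyer.BirchSwinnertonDyer.Theorems.ThetaTransport.AtTwoPackage

open CategoryTheory Field NumberField IsDedekindDomain WeierstrassCurve
  Literature.NumberTheory.EllipticCurves Literature.NumberTheory.GaloisRepresentations
  Literature.NumberTheory.EllipticCurves.GreenbergSelmer Literature.NumberTheory.EllipticCurves.CyclotomicLayer
  Literature.NumberTheory.EllipticCurves.Kobayashi2003 Literature.NumberTheory.EllipticCurves.Sprung2012
  Summit.BirchSwinnertonDyer.BirchSwinnertonDyer.Theorems.OnePair

variable (S : Set (PadicAlgCl 2)) (W : WeierstrassCurve ℚ) [W.IsElliptic] [W.IsGloballyMinimal] (κ : ZpExtension ℚ 2) (γ : absoluteGaloisGroup ℚ)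
  (S₀ : Finset (HeightOneSpectrum (𝓞 ℚ))) (n : ℕ) (ρ : FramedGaloisRep ℚ ↥(padicCoeffIntegers S) 2)
  (Θ : ∀ v : HeightOneSpectrum (𝓞 ℚ), ((2 : ℕ) : 𝓞 ℚ) ∈ v.asIdeal → (Cofree ρ ↥(padicCoeffField S) ≃+ (Fin n → ↥(W.geomPrimaryTorsion 2))))
  (hΘ : ∀ v hv (δ : absoluteGaloisGroup (v.adicCompletion ℚ)) m i,
    Θ v hv (resGalOfEmb (closureEmb (K := ℚ) (v.adicCompletion ℚ)) δ • m) i = resGalOfEmb (closureEmb (K := ℚ) (v.adicCompletion ℚ)) δ • Θ v hv m i)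
  (I : Kato2004.IwasawaH1DataCoeff (FramedGaloisRep.toGaloisRep ρ) 2 κ γ)
  (Sg : AddSubgroup (subgroupH1 κ.kerSubgroup (Cofree ρ ↥(padicCoeffField S)))) [Module ↥(padicCoeffIntegers S) ↥Sg]

/-- **T1 — the AtTwo package EXISTS** (GLUE-SPEC-g18 §1 T1 (a)–(e), in the binder shape of `onePairSupply_of_packages`): for every pin bundle `π` there are a
`ℤ₂`-structure on `D₂` (the functorial one, `dlocModule`), `π₂ : AtTwoPins π` (`c₂` = THE value character), (PERF₂) `Function.Surjective π₂.c₂`, and `E⁺ ≤ D₂`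
with `s ∈ Sg ↔ s ∈ SelRel ∧ loc₂ s ∈ E⁺` and `(∀ e ∈ E⁺, c₂ t e = 0) → colⁿ t = 0`. [cite: Kobayashi2003, Thm. 6.2 and (8.23) (p. 18)]
[cite: PerrinRiou1994Invent, §3.6.1] [cite: MilneADT2006, Ch. I §6] -/
theorem exists_atTwoPins_perfect (hGood : Rank1Residual.GoodSS W 2) (hκ : κ.IsCyclotomic)
    (hmem : ∀ y : subgroupH1 κ.kerSubgroup (Cofree ρ ↥(padicCoeffField S)), y ∈ Sg ↔ y ∈ plusSelmerSet S W κ S₀ n ρ Θ)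
    (π : OnePairPins S W κ γ S₀ n ρ Θ hΘ I Sg) :
    ∃ (inst : Module ℤ_[2] (Dloc S κ ρ π.v))
      (π₂ : (letI : Module ℤ_[2] (Dloc S κ ρ π.v) := inst; AtTwoPins S κ ρ S₀ W γ n Θ hΘ I Sg π)),
      Function.Surjective π₂.c₂ ∧
      ∃ Eplus : AddSubgroup (Dloc S κ ρ π.v),
        (∀ s : subgroupH1 κ.kerSubgroup (Cofree ρ ↥(padicCoeffField S)), s ∈ Sg ↔ s ∈ selRelSubgroup S κ ρ S₀ ∧ locKer S κ ρ π.v s ∈ Eplus) ∧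
        ∀ t : (Fin n → ↥(localTowerPointsOfEmb κ (closureEmb (K := ℚ) (π.v.adicCompletion ℚ)) W)) →+ ℤ_[2],
          (∀ e ∈ Eplus, π₂.c₂ t e = 0) →
          ∀ i : Fin n, π.col (t.comp (AddMonoidHom.single
            (fun _ : Fin n => ↥(localTowerPointsOfEmb κ (closureEmb (K := ℚ) (π.v.adicCompletion ℚ)) W)) i)) = 0 := by
  letI inst : Module ℤ_[2] (Dloc S κ ρ π.v) := dlocModule S κ ρ π.v
  obtain ⟨c₂, hval, hlin⟩ := exists_c₂ S ρ W (Θ π.v π.hv) κ π.v (hΘ π.v π.hv) hGood hκ π.hv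
  let π₂ : AtTwoPins S κ ρ S₀ W γ n Θ hΘ I Sg π :=
    { hD₂ := fun a y ↦ dlocModule_smul_def S κ ρ π.v a y
      c₂ := c₂
      hc₂_smul := fun a t y ↦ by rw [dlocModule_smul_def]; exact hlin a t y
      hc₂ := fun t y ψ Q k hQ hψ hK ↦ hval t y ψ Q k hQ hψ hK }
  obtain ⟨Eplus, hSg, hπker⟩ := exists_Eplus S ρ W κ S₀ Θ hΘ π.v π.hv hκ Sg hmem c₂ hval π.col π.hcol_ker
  exact ⟨inst, π₂, surjective_of_valuePin S ρ W (Θ π.v π.hv) κ π.v (hΘ π.v π.hv) hGood hκ π.hv c₂ hval, Eplus, hSg, hπker⟩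

end Summit.BirchSwinnertonDyer.BirchSwinnertonDyer.Theorems.ThetaTransport.AtTwoPackage

end
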